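import Literature.Claims.NS.ClayVariants
import HarnessLib

/-!
# Claim skeleton (D-0090 NS-CLAIMS, C132; Lean-artefact row, (4a) C110/C125 treatment, T2-low QUICK):
# McSheery 2026 — «Navier-Stokes Global Regularity via Cl(3,3) Phase Space» (GitHub `tracyphasespace/NavierStokes`)

Typed skeleton of Tracy McSheery (GitHub `tracyphasespace`; «CEO, PhaseSpace»), repository
**github.com/tracyphasespace/NavierStokes**, branch `master` at commit
`551044eaba1970247f53afae40723f33ca4e033f` (last push 2026-02-15T06:52:42Z; snapshot tarball sha16
235009f162755151, fetched read-only 2026-08-27T03:26Z by the typist into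
`run/shared/lean/pub/ns-claims/sources/McSheery2026/typist3-fetch/`; the cell's lit seat may supersede it with its
own snapshot of the same commit) = bib `McSheery2026`. Lean 4 toolchain `leanprover/lean4:v4.28.0-rc1`, Mathlib
rev `5352afccd6866369be9de43f5b7ec47203555f44` (lakefile.toml); 83 `.lean` files under `Lean/`; README:
«**Purpose**: CMI Millennium Prize Submission · **Status**: ✅ COMPLETE · Date: 2026-01-14 … Sorries 0 · Axioms 0»;
paper of record inside the repository: `docs/CMI_Combined_Papers.tex` (dated «February 13, 2026», title «Clay
Mathematics Institute Millennium Prize Problem — Global Regularity of the Navier-Stokes Equations — A Resolution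
via Phase Space Embedding in Clifford Algebra Cl(3,3)»; locators «tex l.N»). UNREFEREED CLAIM under adjudication —
NOTHING in this file asserts a statement of the artefact about Navier–Stokes: the artefact's statements are
`def … : Prop`; the `theorem`s are kernel facts about them. The artefact's code is NOT imported (different
toolchain/Mathlib pin; cell rule (4a): no re-build): its analytic vocabulary (`VelocityField`, `DivergenceFree`,
`TestFunction`, `timeDerivTerm`, `advectionTerm`, `viscosityTerm`, `IsWeakNSSolution` —
`Lean/Phase7_Density/PhysicsAxioms.lean` l.52–121) is TRANSCRIBED VERBATIM over Mathlib, and the capstone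
`CMI_global_regularity` (`Lean/Phase7_Density/CMI_Regularity.lean` l.93–103) is transcribed at the grain its proof
uses (`Lean/Phase7_Density/MomentDerivation.lean` l.116–148: only `h_vel_continuous`, `h_initial` and the five
`CalculusRules` fields enter; the 6D objects `Ψ`, `ρ`, `VacuumStructure`, `IsScleronomic`, `h_transport`,
`h_closure`, `h_div_free` are carried but unused by the proof) over PARAMETERS (`CapstoneData`: the moment field
`v = velocityFromEvolution ρ Ψ` and the four auxiliary functionals `stressGradPhi`, `reynoldsGradPhi`,
`deviationGradPhi`, `transposeGradPhi` as free data), exactly as C110 `Strelzoff2026` (`CapstoneData`).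

## The claimed statement
* README l.1–5: «Navier-Stokes Global Regularity via Cl(3,3) Phase Space · Purpose: CMI Millennium Prize
  Submission · Status: ✅ COMPLETE»; `docs/CMI_Combined_Papers.tex` abstract l.73–79: «We present a complete
  resolution of the Clay Millennium Prize problem on the global existence and smoothness of solutions to the
  three-dimensional incompressible Navier-Stokes equations … We prove that: (I) if a "Scleronomic Lift" exists,
  solutions cannot blow up; (II) such a lift exists for all finite-energy initial data via the Boltzmann
  distribution; (III) the viscosity coefficient emerges uniquely from the projection geometry. The resolution …
  is supported by a Lean 4 formalization with zero custom axiom declarations, zero sorries, and zero vacuous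
  definitions»; Theorem [Clay Millennium Prize: Global Regularity] tex l.766–775: «For any divergence-free initial
  velocity field u₀ ∈ L²(ℝ³) with finite energy, there exists a global smooth solution u(t) to the Navier-Stokes
  equations satisfying: 1. u(0) = u₀ (initial condition) 2. u solves NSE weakly (equations satisfied) 3. u exists
  for all t ≥ 0 (no finite-time blow-up)»; `CMI_Regularity.lean` l.9–22: «This file contains the final theorem
  answering the Clay Millennium Problem … "In three space dimensions and time, given an initial velocity field,
  there exists a vector velocity and a scalar pressure field, which are both smooth and globally defined, that
  solve the Navier-Stokes equations."», l.80 «THE CLAY MILLENNIUM PRIZE THEOREM — 0 CUSTOM AXIOMS».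
  TYPED as `ClaimedTheorem := ClayVariants.clayR3.Regularity` (the Clay (A) sentence the README/paper say is
  resolved; `ℝ³` = the artefact's `Position`, `f ≡ 0`).
* The ARTEFACT'S theorem (`CMI_global_regularity`, CMI_Regularity.lean l.93–103), transcribed:
  `CapstoneStatement` — for `ν > 0`, `u₀ : VelocityField` with `Continuous (u₀ 0)`, and capstone data satisfying
  the hypotheses, `∃ u : VelocityField, u 0 = u₀ 0 ∧ IsWeakNSSolution u ν` (`ArtefactConclusion ν u₀`).
  RE-PROVED here by the artefact's own three lines (`capstone_holds`: `rw [R1, R2, R3, R4, R5]; ring`).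

## What the kernel finds about the transcribed objects (facts, std axioms)
* `TestFunction.val_eq_zero`: the artefact's test-function space is `{0}` — its field `smooth : ContDiff ℝ ⊤
  (uncurry val)` (PhysicsAxioms.lean l.70) elaborates, in Mathlib since the `ω` refactor (2024-11; both the
  artefact's pin and ours), to `ContDiff ℝ ω` = real-ANALYTIC on `ℝ × ℝ³`, and the field `compact_supp_space`
  (l.72) makes `val` vanish on the open set `{‖x‖ > R}`; by the identity theorem
  (`AnalyticOnNhd.eqOn_zero_of_preconnected_of_eventuallyEq_zero`) `val ≡ 0`.
* `isWeakNSSolution_iff_continuous`: hence `IsWeakNSSolution u ν ↔ ∀ t, Continuous (u t)` — the three integral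
  terms vanish at `φ = 0`; the «VECTOR weak formulation with the nonlinear advection term» (l.108–121) constrains
  nothing beyond spatial continuity.
* `artefactConclusion_holds`: hence the capstone's CONCLUSION `∃ u, u 0 = u₀ 0 ∧ IsWeakNSSolution u ν` holds for
  every `ν` and every `u₀` with `Continuous (u₀ 0)` — by the frozen field `u t := u₀ 0` — with NO hypothesis
  (no `VacuumStructure`, no `ScleronomicKineticEvolution`).
* `exists_rules_iff_identity`: at the parameter grain and for ANY family of test fields (so also for a charitable
  re-typing with `C^∞` test functions), the five «calculus rules» R1–R5 are jointly satisfiable for a field `v`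
  iff `v` satisfies the weak identity `timeDerivTerm + advectionTerm = ν · viscosityTerm` on that family — the
  hypothesis `h_calculus` of `ScleronomicKineticEvolution` carries the conclusion's identity (ROUTE-5b record).
* `step_lift_iff_artefactConclusion`, `step_lift_holds`, `step_bridge_iff_clay`: see the Steps.

## Delta to Clay (`ClayVariants` §2 matrix) — at the STATEMENT of the artefact's theorem
Δ1 domain: `Position = ℝ³` for `x` ✓ (momentum variable on `Torus3 = Fin 3 → AddCircle (2π)` with a
caller-supplied `[MeasureSpace Torus3]` instance — any measure). Δ2 equations: `IsWeakNSSolution` = spatial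
continuity + a distributional identity against divergence-free test fields on `ℝ_t × ℝ³` (no pressure — admissible
for divergence-free tests —, NO divergence-free condition on `u` itself, NO initial-value formulation: the time
axis is all of `ℝ` and the datum enters only as `u 0 = u₀ 0`); with the artefact's test space `= {0}` the identity
is EMPTY (`isWeakNSSolution_iff_continuous`). Δ3 `f ≡ 0` ✓. Δ4 data: `u₀ 0` merely `Continuous` (tex: «u₀ ∈ L²
divergence-free»; README: «smooth, divergence-free … finite energy») — WIDER than (4). Δ5 solution class: continuous
in `x` for each `t`; no smoothness in `t` or `x`, no `p`, no bounded energy (7) — vs Clay's `C^∞(ℝ³ × [0,∞))` + (7);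
the paper's own item «2. u solves NSE weakly». Δ6 conclusion: existence of such a `u` only. Δ7 `ν > 0` ✓ (with
`VacuumStructure … nu_pos`). `clay_of_artefact` is NOT typable (no map from `IsWeakNSSolution` to
`IsNavierStokesSolution`/`IsSmoothOnHalfSpace`/`HasBoundedEnergy`); the converse is not typable either (a Clay
solution lives on `[0,∞)`).

## Ordered Step index (artefact/print order)
* Step 1 = `Step_capstone := CapstoneStatement` — the artefact's theorem `CMI_global_regularity`
  (CMI_Regularity.lean l.93–103 ← `global_regularity_from_scleronomic` DynamicsBridge.lean l.57–70 ←
  `moment_projection_satisfies_NS` MomentDerivation.lean l.116–148). TRUE (`capstone_holds`).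
* Step 2 = `Step_lift` — the capstone's HYPOTHESIS `ev : ScleronomicKineticEvolution u₀ ρ ν` exists for every
  datum (README «Paper 2: Topological Existence (COMPLETE ✅) Claim: Lifts exist via symplectic structure and
  Hamiltonian flow»; «Paper 3 … Lift construction Λ `Lean/Phase7_Density/LiftConstruction.lean` ✅» — that file is
  ARCHIVED in the snapshot as `Lean/archive/Phase7_Density/LiftConstruction.leantxt`, «placeholder constants»
  (Phase7_Density.lean l.35, EnergyConservation.lean l.4); tex Theorem [Existence of Scleronomic Lift] l.581–600,
  item 3 «Ψ₀ admits scleronomic evolution (Stability)» proved by the one line «By Theorem [Lift Preserves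
  Regularity] and the well-posedness results of Chapter 1, the scleronomic evolution exists and is unique»; tex
  Theorem [CMI] proof Steps 1–2 l.777–781). Typed at the parameter grain: `∃ X, CapstoneHypotheses ν u₀ X`.
  Kernel: `step_lift_iff_artefactConclusion` (the hypothesis is satisfiable iff the conclusion holds — circular at
  this grain) and therefore `step_lift_holds` (since the conclusion holds trivially).
* Step 3 = `Step_bridge` — the identification of the artefact's conclusion with the Millennium statement
  (CMI_Regularity.lean l.9–22, l.80; README l.3–5; tex l.766 theorem title «Clay Millennium Prize: Global
  Regularity», abstract l.75 «complete resolution»): `(∀ ν > 0, ∀ u₀, Continuous (u₀ 0) → ArtefactConclusion ν u₀)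
  → clayR3.Regularity`. LOAD-BEARING: `step_bridge_iff_clay : Step_bridge ↔ clayR3.Regularity` — the whole of (A)
  sits in this implication, whose antecedent is a kernel triviality (`artefactConclusion_holds`).
COMPOSITION: `claim_of_steps : Step_capstone → Step_lift → Step_bridge → ClaimedTheorem` (PROVED; pure logic).
* Section E records the three OTHER statements the repository advertises as top theorems (lit-2 g3
  `sources/McSheery2026/LOCATORS.md` §1 (a)–(c)): `QFD.Clay.clay_global_regularity` (ClayEquivalence.lean
  l.150–174; a «Clay-admissible datum» is one vector of `ℝ³`; conclusion = existence of the number `2·energy`),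
  `global_regularity_3D` (Projection_Regularity.lean l.258–270; re-emits its hypothesis field
  `energy_preserved`), `Global_Regularity_Principle` (NavierStokes_Master.lean l.209–216; `[u,u] = 0 ∧ {u,u} =
  2u²` in `Cl(3,3)`) — transcribed verbatim (`ClayEquivalenceStatement`, `MainRegularityStatement`,
  `GlobalRegularityPrinciple`) and RE-PROVED (`…_holds`); none mentions a velocity field, an equation or a
  solution. The Phase-7 capstone above is the artefact's most analytic statement and the one its
  `Validation/HonestyAudit.lean` and `CMI_Regularity.lean` present as «THE CLAY MILLENNIUM PRIZE THEOREM».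

## References
* GitHub `tracyphasespace/NavierStokes` @ 551044e (`McSheery2026`): README.md; Lean/Phase7_Density/{PhysicsAxioms,
  CMI_Regularity, DynamicsBridge, MomentDerivation, MomentProjection, FunctionSpaces}.lean;
  Lean/Validation/HonestyAudit.lean; docs/CMI_Combined_Papers.tex (2026-02-13).
* Cell files: `claims/McSheery2026/CARD.md` (typist-3 g3; PREDICTION 2026-08-27T03:24:58Z, sha16 e41419e5086a3edb,
  blind on every `.lean`), `sources/McSheery2026/` (snapshot), precedent `Literature.Claims.NS.Strelzoff2026` (C110).

WHAT THIS IS NOT: not a claim about NS regularity or blow-up; not a claim about any author beyond the typed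
locator.
-/

noncomputable section

open Set MeasureTheory Filter Topology Function
open scoped ContDiff

namespace Literature.Claims.NS.McSheery2026

open Literature.Analysis.FluidPDE Literature.Claims.NS.ClayVariants

/-! ## A. The artefact's analytic vocabulary, transcribed verbatim (`Lean/Phase7_Density/PhysicsAxioms.lean`) -/

/-- «Velocity field type» (PhysicsAxioms.lean l.51–52, verbatim). [cite: McSheery2026, Lean/Phase7_Density/PhysicsAxioms.lean l.52] -/
abbrev VelocityField : Type := ℝ → EuclideanSpace ℝ (Fin 3) → EuclideanSpace ℝ (Fin 3)

/-- «Position type» (l.54–55, verbatim). [cite: McSheery2026, Lean/Phase7_Density/PhysicsAxioms.lean l.55] -/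
abbrev Position : Type := EuclideanSpace ℝ (Fin 3)

/-- «Divergence-free condition for a time-dependent vector field. ∑ᵢ ∂φᵢ/∂xᵢ = 0 at every point. Uses Mathlib's
`fderiv` for genuine divergence» (l.57–62, verbatim). [cite: McSheery2026, Lean/Phase7_Density/PhysicsAxioms.lean l.60–62] -/
def DivergenceFree (φ : ℝ → Position → Position) : Prop :=
  ∀ (t : ℝ) (x : Position),
    ∑ i : Fin 3, fderiv ℝ (fun y => φ t y i) x (EuclideanSpace.single i 1) = 0

/-- «The space of divergence-free test functions. We use 'ContDiff' to make this standard-compliant. Compact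
support is encoded explicitly via bounds» (l.64–77, verbatim — including the smoothness exponent AS WRITTEN,
`ContDiff ℝ ⊤`, which elaborates to `ContDiff ℝ ω`, real-analytic: see `TestFunction.val_eq_zero`).
[claim: McSheery2026, status: under-review] [cite: McSheery2026, Lean/Phase7_Density/PhysicsAxioms.lean l.69–77] -/
structure TestFunction where
  val : ℝ → Position → Position
  smooth : ContDiff ℝ ⊤ (uncurry val)
  -- Compact support in space: ∃ bounded set K such that φ = 0 outside K
  compact_supp_space : ∃ (R : ℝ), R > 0 ∧ ∀ (t : ℝ) (x : Position), ‖x‖ > R → val t x = 0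
  -- Compact support in time
  compact_supp_time : ∃ (T : ℝ), T > 0 ∧ ∀ (t : ℝ), |t| > T → ∀ (x : Position), val t x = 0
  -- Divergence free condition (genuine, using fderiv)
  div_free : DivergenceFree val

/-- «Time derivative term: ∫∫ u · ∂ₜφ dx dt. CONCRETE DEFINITION using fderiv + Bochner integral» (l.79–85,
verbatim). [cite: McSheery2026, Lean/Phase7_Density/PhysicsAxioms.lean l.83–85] -/
def timeDerivTerm (u : VelocityField) (φ : ℝ → Position → Position) : ℝ :=
  ∫ t : ℝ, ∫ x : Position,
    @inner ℝ _ _ (u t x) (fderiv ℝ (fun s => φ s x) t 1)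

/-- «Advection term: ∫∫ (u⊗u):∇φ dx dt = Σᵢⱼ uᵢ uⱼ ∂φⱼ/∂xᵢ» (l.87–94, verbatim).
[cite: McSheery2026, Lean/Phase7_Density/PhysicsAxioms.lean l.90–94] -/
def advectionTerm (u : VelocityField) (φ : ℝ → Position → Position) : ℝ :=
  ∫ t : ℝ, ∫ x : Position,
    ∑ i : Fin 3, ∑ j : Fin 3,
      u t x i * u t x j *
      fderiv ℝ (fun y => (φ t y) j) x (EuclideanSpace.single i 1)

/-- «Viscosity term: ∫∫ ∇u:∇φ dx dt = Σᵢⱼ (∂uᵢ/∂xⱼ)(∂φᵢ/∂xⱼ)» (l.96–103, verbatim).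
[cite: McSheery2026, Lean/Phase7_Density/PhysicsAxioms.lean l.99–103] -/
def viscosityTerm (u : VelocityField) (φ : ℝ → Position → Position) : ℝ :=
  ∫ t : ℝ, ∫ x : Position,
    ∑ i : Fin 3, ∑ j : Fin 3,
      fderiv ℝ (fun y => (u t y) i) x (EuclideanSpace.single j 1) *
      fderiv ℝ (fun y => (φ t y) i) x (EuclideanSpace.single j 1)

/-- «The Standard Weak Formulation of Navier-Stokes. This is the rigorous definition that makes the proof
respectable. A velocity field u(t,x) is a weak solution if: 1. u is continuous in space for each time 2. The
integral identity holds against all test functions: ∫ u·∂ₜφ + ∫ (u⊗u):∇φ = ν ∫ ∇u:∇φ» (l.105–121, verbatim).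
[claim: McSheery2026, status: under-review] [cite: McSheery2026, Lean/Phase7_Density/PhysicsAxioms.lean l.113–121] -/
def IsWeakNSSolution (u : VelocityField) (ν : ℝ) : Prop :=
  -- 1. Regularity (Continuous in space for each time)
  (∀ t, Continuous (u t)) ∧
  -- 2. The Integral Identity (distributional NS)
  ∀ (φ : TestFunction),
    timeDerivTerm u φ.val + advectionTerm u φ.val = ν * viscosityTerm u φ.val

/-! ## B. The artefact's capstone, transcribed over PARAMETERS -/

/-- The conclusion of `CMI_global_regularity` (CMI_Regularity.lean l.100–102, verbatim up to naming):
`∃ u : VelocityField, (u 0 = u₀ 0) ∧ IsWeakNSSolution u ν`. [claim: McSheery2026, status: under-review]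
[cite: McSheery2026, Lean/Phase7_Density/CMI_Regularity.lean l.100–102] -/
def ArtefactConclusion (ν : ℝ) (u₀ : VelocityField) : Prop :=
  ∃ u : VelocityField, u 0 = u₀ 0 ∧ IsWeakNSSolution u ν

/-- The data the capstone's proof manipulates, as PARAMETERS (C110 pattern): the moment field
`v = velocityFromEvolution ρ Ψ` (MomentProjection.lean l.68–70) and the four auxiliary functionals of a test field
`stressGradPhi ρ Ψ`, `reynoldsGradPhi ρ Ψ`, `deviationGradPhi ρ Ψ`, `transposeGradPhi ρ Ψ` (PhysicsAxioms.lean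
l.489–522), about which nothing is assumed here. [cite: McSheery2026, Lean/Phase7_Density/PhysicsAxioms.lean l.489–522] -/
structure CapstoneData where
  /-- the velocity moment field `velocityFromEvolution ρ Ψ`. -/
  v : VelocityField
  /-- `stressGradPhi ρ Ψ`. -/
  stress : (ℝ → Position → Position) → ℝ
  /-- `reynoldsGradPhi ρ Ψ`. -/
  reynolds : (ℝ → Position → Position) → ℝ
  /-- `deviationGradPhi ρ Ψ`. -/
  deviation : (ℝ → Position → Position) → ℝ
  /-- `transposeGradPhi ρ Ψ`. -/
  transpose : (ℝ → Position → Position) → ℝ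

/-- The fields of `ScleronomicKineticEvolution u₀ ρ ν` (PhysicsAxioms.lean l.558–611) that the capstone's proof
USES (MomentDerivation.lean l.135–148: `h_vel_cont`, then `rw [R1, R2, R3, R4, R5]; ring`), verbatim over the
parameters: `h_initial` (l.565), `h_vel_continuous` (l.570), and the five `CalculusRules` (l.525–545) «Standard
calculus identities … stated as explicit hypotheses … **Physical content**: NONE — pure analysis/calculus rules»:
R1 `time_deriv_to_stress` «Leibniz + transport + time IBP: ∫∫ u·∂ₜφ = -∫∫ T:∇φ», R2 `stress_splits`, R3
`advection_from_reynolds`, R4 `deviation_to_viscous` «Closure under integral: ∫∫ σ:∇φ = -ν(∫∫ ∇u:∇φ + ∫∫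
(∇u)ᵀ:∇φ)», R5 `transpose_vanishes`. (The carried-but-unused fields `Ψ`, `h_scleronomic`, `h_div_free`,
`h_transport`, `h_closure` and the arguments `ρ`, `VacuumStructure ρ ν` do not enter the proof and are not
transcribed.) [claim: McSheery2026, status: under-review] [cite: McSheery2026, Lean/Phase7_Density/PhysicsAxioms.lean l.525–545, l.558–611] -/
structure CapstoneHypotheses (ν : ℝ) (u₀ : VelocityField) (X : CapstoneData) : Prop where
  h_initial : X.v 0 = u₀ 0
  h_vel_continuous : ∀ t, Continuous (X.v t)
  time_deriv_to_stress : ∀ φ : TestFunction, timeDerivTerm X.v φ.val = -(X.stress φ.val)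
  stress_splits : ∀ φ : TestFunction, X.stress φ.val = X.reynolds φ.val + X.deviation φ.val
  advection_from_reynolds : ∀ φ : TestFunction, advectionTerm X.v φ.val = X.reynolds φ.val
  deviation_to_viscous : ∀ φ : TestFunction,
    X.deviation φ.val = -(ν * viscosityTerm X.v φ.val) + -(ν * X.transpose φ.val)
  transpose_vanishes : ∀ φ : TestFunction, X.transpose φ.val = 0

/-- **The artefact's capstone `CMI_global_regularity`** (CMI_Regularity.lean l.80–103: «THE CLAY MILLENNIUM PRIZE
THEOREM — 0 CUSTOM AXIOMS … theorem CMI_global_regularity (ν : ℝ) (hν : ν > 0) (u₀ : VelocityField) (h_cont :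
Continuous (u₀ 0)) (ρ : SmoothWeight) (hv : VacuumStructure ρ ν) (ev : ScleronomicKineticEvolution u₀ ρ ν) :
∃ u : VelocityField, (u 0 = u₀ 0) ∧ IsWeakNSSolution u ν»), transcribed over the parameters.
[claim: McSheery2026, status: under-review] [cite: McSheery2026, Lean/Phase7_Density/CMI_Regularity.lean l.93–103] -/
def CapstoneStatement : Prop :=
  ∀ ν : ℝ, ν > 0 → ∀ u₀ : VelocityField, Continuous (u₀ 0) →
    ∀ X : CapstoneData, CapstoneHypotheses ν u₀ X → ArtefactConclusion ν u₀

/-! ## C. The claimed statement and the Steps -/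

/-- **CLAIMED THEOREM** — the Clay sentence the artefact says it resolves (README l.1–5 «Navier-Stokes Global
Regularity … Purpose: CMI Millennium Prize Submission · Status: ✅ COMPLETE»; tex abstract l.75 «a complete
resolution of the Clay Millennium Prize problem on the global existence and smoothness …»; tex Theorem [Clay
Millennium Prize: Global Regularity] l.766–775; CMI_Regularity.lean l.9–22, l.80): Clay (A) on `ℝ³` with `f ≡ 0`,
referenced (not restated) as `ClayVariants.clayR3.Regularity`. [claim: McSheery2026, status: under-review]
[cite: McSheery2026, README l.1–5; docs/CMI_Combined_Papers.tex l.73–79, l.766–775; Lean/Phase7_Density/CMI_Regularity.lean l.9–22] -/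
def ClaimedTheorem : Prop :=
  clayR3.Regularity

/-- **Step 1 — the capstone** (the artefact's machine-checked theorem, transcribed): `CapstoneStatement`.
[claim: McSheery2026, status: under-review] [cite: McSheery2026, Lean/Phase7_Density/CMI_Regularity.lean l.93–103] -/
def Step_capstone : Prop :=
  CapstoneStatement

/-- **Step 2 — «lifts exist»**: the capstone's hypothesis is available for every datum (README l.54–62 «Paper 2:
Topological Existence (COMPLETE ✅) **Claim**: Lifts exist via symplectic structure and Hamiltonian flow»; tex
Theorem [Existence of Scleronomic Lift] l.581–600, item 3 «Ψ₀ admits scleronomic evolution» with the one-line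
proof «By Theorem [Lift Preserves Regularity] and the well-posedness results of Chapter 1, the scleronomic
evolution exists and is unique»; tex Theorem [CMI] proof Steps 1–2 l.777–781; in the Lean build the existence is
the ARGUMENT `ev : ScleronomicKineticEvolution u₀ ρ ν` of the capstone, and `LiftConstruction.lean` is archived as
«placeholder constants»). Typed at the parameter grain. [claim: McSheery2026, status: under-review]
[cite: McSheery2026, README l.54–62; docs/CMI_Combined_Papers.tex l.581–600, l.777–781; Lean/Phase7_Density/CMI_Regularity.lean l.99] -/
def Step_lift : Prop :=
  ∀ ν : ℝ, ν > 0 → ∀ u₀ : VelocityField, Continuous (u₀ 0) →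
    ∃ X : CapstoneData, CapstoneHypotheses ν u₀ X

/-- **Step 3 — the bridge** (CMI_Regularity.lean l.9–22 «This file contains the final theorem answering the Clay
Millennium Problem»; l.80 «THE CLAY MILLENNIUM PRIZE THEOREM»; README l.3–5; tex l.766 / l.75): the artefact's
conclusion for all data IS the Millennium statement. LOAD-BEARING (`step_bridge_iff_clay`).
[claim: McSheery2026, status: under-review] [cite: McSheery2026, Lean/Phase7_Density/CMI_Regularity.lean l.9–22, l.80; README l.3–5; docs/CMI_Combined_Papers.tex l.75, l.766–775] -/
def Step_bridge : Prop :=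
  (∀ ν : ℝ, ν > 0 → ∀ u₀ : VelocityField, Continuous (u₀ 0) → ArtefactConclusion ν u₀) → clayR3.Regularity

/-! ## D. Kernel facts -/

/-! ### D.1 The capstone holds (the artefact's own proof, re-run) -/

/-- The five rules give the weak identity by rewriting (MomentDerivation.lean l.141–148 «rw [R1, R2, R3, R4, R5];
ring», re-run over the parameters). [cite: McSheery2026, Lean/Phase7_Density/MomentDerivation.lean l.135–148] -/
theorem identity_of_rules {ν : ℝ} {u₀ : VelocityField} {X : CapstoneData} (h : CapstoneHypotheses ν u₀ X)
    (φ : TestFunction) :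
    timeDerivTerm X.v φ.val + advectionTerm X.v φ.val = ν * viscosityTerm X.v φ.val := by
  rw [h.time_deriv_to_stress φ, h.stress_splits φ, h.advection_from_reynolds φ, h.deviation_to_viscous φ,
    h.transpose_vanishes φ]
  ring

/-- **Step 1 holds**: the transcribed capstone is a theorem (the artefact's proof: `u := velocityFromEvolution ρ Ψ`,
`h_initial`, `h_vel_continuous`, and the rewriting above — CMI_Regularity.lean l.103, DynamicsBridge.lean
l.66–70, MomentDerivation.lean l.135–148). [cite: McSheery2026, Lean/Phase7_Density/CMI_Regularity.lean l.93–103] -/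
theorem capstone_holds : CapstoneStatement :=
  fun _ _ _ _ X h => ⟨X.v, h.h_initial, h.h_vel_continuous, identity_of_rules h⟩

/-- `Step_capstone` holds. [cite: McSheery2026, Lean/Phase7_Density/CMI_Regularity.lean l.93–103] -/
theorem step_capstone_holds : Step_capstone :=
  capstone_holds

/-! ### D.2 The artefact's test-function space is `{0}`; its weak formulation is spatial continuity -/

/-- **Every `TestFunction` of the artefact is identically zero.** Its smoothness field `ContDiff ℝ ⊤ (uncurry val)`
is `ContDiff ℝ ω`, i.e. `uncurry val` is real-analytic on `ℝ × ℝ³` (`ContDiff.analyticOnNhd`), and by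
`compact_supp_space` it vanishes on the non-empty open set `{(t,x) | ‖x‖ > R}`; `ℝ × ℝ³` being preconnected, the
identity theorem gives `val ≡ 0`. [cite: McSheery2026, Lean/Phase7_Density/PhysicsAxioms.lean l.69–73] -/
theorem TestFunction.val_eq_zero (φ : TestFunction) (t : ℝ) (x : Position) : φ.val t x = 0 := by
  obtain ⟨R, hR, hφ⟩ := φ.compact_supp_space
  have han : AnalyticOnNhd ℝ (uncurry φ.val) univ := φ.smooth.analyticOnNhd
  set x₀ : Position := PiLp.single 2 (0 : Fin 3) (R + 1) with hx₀
  have hnorm : ‖x₀‖ = R + 1 := by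
    rw [hx₀, PiLp.norm_single, Real.norm_eq_abs, abs_of_pos (by linarith)]
  have hopen : IsOpen {z : ℝ × Position | R < ‖z.2‖} :=
    isOpen_lt continuous_const (continuous_norm.comp continuous_snd)
  have hmem : ((0 : ℝ), x₀) ∈ {z : ℝ × Position | R < ‖z.2‖} := by
    show R < ‖x₀‖
    rw [hnorm]; linarith
  have hev : uncurry φ.val =ᶠ[𝓝 ((0 : ℝ), x₀)] 0 := by
    filter_upwards [hopen.mem_nhds hmem] with z hz
    exact hφ z.1 z.2 hz
  have h := han.eqOn_zero_of_preconnected_of_eventuallyEq_zero isPreconnected_univ (mem_univ _) hev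
  exact h (mem_univ (t, x))

/-- The same, as a function identity. [cite: McSheery2026, Lean/Phase7_Density/PhysicsAxioms.lean l.69–73] -/
theorem TestFunction.val_eq_zero' (φ : TestFunction) : φ.val = fun _ _ => 0 := by
  funext t x; exact φ.val_eq_zero t x

/-- The zero field is a `TestFunction` (so the space is exactly `{0}`, non-empty). [cite: McSheery2026, Lean/Phase7_Density/PhysicsAxioms.lean l.69–77] -/
def TestFunction.zero : TestFunction where
  val := fun _ _ => 0
  smooth := contDiff_const
  compact_supp_space := ⟨1, one_pos, fun _ _ _ => rfl⟩
  compact_supp_time := ⟨1, one_pos, fun _ _ _ => rfl⟩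
  div_free := fun t x => by simp

/-- The three integral terms vanish on the zero test field. [cite: McSheery2026, Lean/Phase7_Density/PhysicsAxioms.lean l.83–103] -/
theorem terms_zero (u : VelocityField) :
    timeDerivTerm u (fun _ _ => 0) = 0 ∧ advectionTerm u (fun _ _ => 0) = 0 ∧
      viscosityTerm u (fun _ _ => 0) = 0 := by
  refine ⟨?_, ?_, ?_⟩
  · simp [timeDerivTerm]
  · simp [advectionTerm]
  · simp [viscosityTerm]

/-- **The artefact's weak formulation is spatial continuity**: `IsWeakNSSolution u ν ↔ ∀ t, Continuous (u t)` —
the integral identity is tested against the zero field only. [cite: McSheery2026, Lean/Phase7_Density/PhysicsAxioms.lean l.113–121] -/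
theorem isWeakNSSolution_iff_continuous (u : VelocityField) (ν : ℝ) :
    IsWeakNSSolution u ν ↔ ∀ t, Continuous (u t) := by
  constructor
  · exact fun h => h.1
  · intro h
    refine ⟨h, fun φ => ?_⟩
    obtain ⟨h1, h2, h3⟩ := terms_zero u
    rw [φ.val_eq_zero', h1, h2, h3]
    ring

/-- **The capstone's CONCLUSION holds with no hypothesis at all**: for every `ν` and every `u₀` with `u₀ 0`
continuous, `∃ u, u 0 = u₀ 0 ∧ IsWeakNSSolution u ν` — witnessed by the time-frozen field `u t := u₀ 0`. (No
`VacuumStructure`, no `ScleronomicKineticEvolution`, no `ν > 0`.)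
[cite: McSheery2026, Lean/Phase7_Density/CMI_Regularity.lean l.100–102] -/
theorem artefactConclusion_holds (ν : ℝ) (u₀ : VelocityField) (h : Continuous (u₀ 0)) :
    ArtefactConclusion ν u₀ :=
  ⟨fun _ => u₀ 0, rfl, (isWeakNSSolution_iff_continuous _ ν).2 fun _ => h⟩

/-! ### D.3 The hypothesis carries the conclusion (parameter grain, any test family) -/

/-- **ROUTE-5b record, grain-independent.** For a field `v`, a real `ν` and ANY family `𝒯` of test fields (in
particular the artefact's `TestFunction`s, or the `C^∞` compactly supported divergence-free fields of a
charitable re-typing of `ContDiff ℝ ⊤` as `ContDiff ℝ ∞`), auxiliary functionals `stress`, `reynolds`,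
`deviation`, `transpose` obeying the five «calculus rules» R1–R5 on `𝒯` EXIST iff `v` satisfies the weak identity
`timeDerivTerm + advectionTerm = ν · viscosityTerm` on `𝒯`: the rules are a re-bracketing of the identity
(⇐: `stress := −timeDerivTerm v`, `reynolds := advectionTerm v`, `deviation := −ν·viscosityTerm v`,
`transpose := 0`). [cite: McSheery2026, Lean/Phase7_Density/PhysicsAxioms.lean l.525–545; Lean/Phase7_Density/MomentDerivation.lean l.141–148] -/
theorem exists_rules_iff_identity (v : VelocityField) (ν : ℝ) (𝒯 : Set (ℝ → Position → Position)) :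
    (∃ stress reynolds deviation transpose : (ℝ → Position → Position) → ℝ,
        ∀ φ ∈ 𝒯,
          timeDerivTerm v φ = -(stress φ) ∧
          stress φ = reynolds φ + deviation φ ∧
          advectionTerm v φ = reynolds φ ∧
          deviation φ = -(ν * viscosityTerm v φ) + -(ν * transpose φ) ∧
          transpose φ = 0) ↔
      ∀ φ ∈ 𝒯, timeDerivTerm v φ + advectionTerm v φ = ν * viscosityTerm v φ := by
  constructor
  · rintro ⟨S, R, D, T, h⟩ φ hφ
    obtain ⟨r1, r2, r3, r4, r5⟩ := h φ hφ
    rw [r1, r2, r3, r4, r5]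
    ring
  · intro h
    refine ⟨fun φ => -timeDerivTerm v φ, fun φ => advectionTerm v φ,
      fun φ => -(ν * viscosityTerm v φ), fun _ => 0, fun φ hφ => ⟨by ring, ?_, rfl, by ring, rfl⟩⟩
    have := h φ hφ
    linarith

/-- **Step 2 is circular at the typed grain**: the capstone's hypothesis is available for every datum iff the
capstone's conclusion holds for every datum. [cite: McSheery2026, Lean/Phase7_Density/PhysicsAxioms.lean l.558–611; Lean/Phase7_Density/CMI_Regularity.lean l.93–103] -/
theorem step_lift_iff_artefactConclusion :
    Step_lift ↔ ∀ ν : ℝ, ν > 0 → ∀ u₀ : VelocityField, Continuous (u₀ 0) → ArtefactConclusion ν u₀ := by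
  constructor
  · intro h ν hν u₀ hc
    obtain ⟨X, hX⟩ := h ν hν u₀ hc
    exact capstone_holds ν hν u₀ hc X hX
  · intro h ν hν u₀ hc
    obtain ⟨u, hu0, hcont, hid⟩ := h ν hν u₀ hc
    refine ⟨⟨u, fun φ => -timeDerivTerm u φ, fun φ => advectionTerm u φ,
      fun φ => -(ν * viscosityTerm u φ), fun _ => 0⟩, ?_⟩
    exact
      { h_initial := hu0
        h_vel_continuous := hcont
        time_deriv_to_stress := fun φ => by simp
        stress_splits := fun φ => by have := hid φ; simp; linarith
        advection_from_reynolds := fun φ => rfl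
        deviation_to_viscous := fun φ => by simp
        transpose_vanishes := fun φ => rfl }

/-- **Step 2 holds at the typed grain** (because the conclusion holds trivially, `artefactConclusion_holds`).
[cite: McSheery2026, Lean/Phase7_Density/CMI_Regularity.lean l.99] -/
theorem step_lift_holds : Step_lift :=
  step_lift_iff_artefactConclusion.2 fun ν _ u₀ hc => artefactConclusion_holds ν u₀ hc

/-! ### D.4 The bridge is Clay (A) itself -/

/-- **`Step_bridge ↔ clayR3.Regularity`**: the antecedent of the bridge is a kernel triviality, so the
identification «artefact conclusion = Millennium theorem» carries exactly Clay (A).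
[cite: McSheery2026, Lean/Phase7_Density/CMI_Regularity.lean l.9–22, l.80] [cite: FeffermanClay2006, (A) p. 2] -/
theorem step_bridge_iff_clay : Step_bridge ↔ clayR3.Regularity :=
  ⟨fun h => h fun ν _ u₀ hc => artefactConclusion_holds ν u₀ hc, fun h _ => h⟩

/-- **COMPOSITION** (README «Three Papers» l.44–75; tex Theorem [CMI] proof l.776–784): capstone, lift, bridge
⇒ the claimed theorem. Pure logic. [cite: McSheery2026, docs/CMI_Combined_Papers.tex l.776–784] -/
theorem claim_of_steps (h₁ : Step_capstone) (h₂ : Step_lift) (h₃ : Step_bridge) : ClaimedTheorem :=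
  h₃ fun ν hν u₀ hc => by
    obtain ⟨X, hX⟩ := h₂ ν hν u₀ hc
    exact h₁ ν hν u₀ hc X hX

/-- The composition therefore reduces to the bridge alone. [cite: McSheery2026, Lean/Phase7_Density/CMI_Regularity.lean l.9–22] -/
theorem claim_iff_step_bridge : (Step_bridge → ClaimedTheorem) ∧ (ClaimedTheorem → Step_bridge) :=
  ⟨fun h => claim_of_steps step_capstone_holds step_lift_holds h, fun h _ => h⟩

/-! ## E. The three other statements the repository advertises as its top theorems (lit-2 g3 LOCATORS §1
(a)–(c)), transcribed verbatim over their own (real-number / ring) data and RE-PROVED: none mentions a velocity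
field, an equation, a solution or time evolution. Recorded so that the adjudication covers every advertised
«capstone»; the bridge from any of them to (A) is again (A) itself. -/

/-- `ClayEquivalence.lean` l.37–48 (namespace `QFD.Clay`): «**Definition: Clay-Admissible Initial Data** Per the
official Clay problem statement, initial data must be: Divergence-free (incompressible) · Smooth (C^∞) · With
finite energy» — transcribed verbatim: a «datum» is ONE vector `(v_x, v_y, v_z) ∈ ℝ³` with the number
`energy = v_x² + v_y² + v_z²`. [claim: McSheery2026, status: under-review] [cite: McSheery2026, Lean/Phase5_Equivalence/ClayEquivalence.lean l.37–48] -/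
structure ClayInitialData where
  v_x : ℝ
  v_y : ℝ
  v_z : ℝ
  energy : ℝ
  energy_nonneg : energy ≥ 0
  energy_eq : energy = v_x ^ 2 + v_y ^ 2 + v_z ^ 2

/-- `ClayEquivalence.lean` l.150–174 «**THE CLAY EQUIVALENCE THEOREM** For every Clay-admissible initial datum:
1. There exists a 6D state Ψ with projection = initial velocity 2. Energy is conserved: H(t) = H(0) 3. Velocity is
bounded: |v(t)|² ≤ 2H(0) 4. Therefore: NO FINITE-TIME BLOW-UP» — the TYPE of `theorem clay_global_regularity
(init : ClayInitialData)`, verbatim: the existence of the real number `2 · energy`.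
[claim: McSheery2026, status: under-review] [cite: McSheery2026, Lean/Phase5_Equivalence/ClayEquivalence.lean l.160–164] -/
def ClayEquivalenceStatement : Prop :=
  ∀ init : ClayInitialData,
    ∃ (H₀ : ℝ), H₀ ≥ 0 ∧ ∀ t : ℝ, t ≥ 0 → ∃ (v_bound : ℝ), v_bound = 2 * H₀ ∧ v_bound ≥ 0

/-- `clay_global_regularity` holds (its own proof, l.165–174: `use init.energy … use 2 * init.energy`).
[cite: McSheery2026, Lean/Phase5_Equivalence/ClayEquivalence.lean l.165–174] -/
theorem clayEquivalenceStatement_holds : ClayEquivalenceStatement :=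
  fun init => ⟨init.energy, init.energy_nonneg, fun _ _ =>
    ⟨2 * init.energy, rfl, by linarith [init.energy_nonneg]⟩⟩

/-- `Projection_Regularity.lean` l.54–90: a «6D state» = three reals (`SpatialProjection`, the «visible 3D
velocity»), a «temporal» and an «internal» real, and `energy = |spatial|² + temporal² + internal²`; l.249–256
`RegularityChain` with the HYPOTHESIS field `energy_preserved : ∀ t ≥ 0, ∃ state_t, state_t.energy ≤
initial_state.energy`. Transcribed verbatim. [claim: McSheery2026, status: under-review] [cite: McSheery2026, Lean/Phase4_Regularity/Projection_Regularity.lean l.54–90, l.249–256] -/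
structure FullState6D where
  x : ℝ
  y : ℝ
  z : ℝ
  temporal : ℝ
  internal : ℝ
  energy : ℝ
  energy_decomp : energy = (x ^ 2 + y ^ 2 + z ^ 2) + temporal ^ 2 + internal ^ 2

/-- `RegularityChain` (l.249–256), verbatim over `FullState6D`. [cite: McSheery2026, Lean/Phase4_Regularity/Projection_Regularity.lean l.249–256] -/
structure RegularityChain where
  initial_state : FullState6D
  energy_pos : initial_state.energy ≥ 0
  energy_bound : ℝ
  energy_bounded : initial_state.energy ≤ energy_bound
  energy_preserved : ∀ t : ℝ, t ≥ 0 → ∃ state_t : FullState6D, state_t.energy ≤ initial_state.energy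

/-- `Projection_Regularity.lean` l.258–266 «**THE MAIN REGULARITY THEOREM** Given a valid RegularityChain, the 3D
projected velocity remains bounded» (README l.125: «theorem global_regularity_3D : ∀ t ≥ 0, ‖u(t)‖ ≤
E(Ψ₀)^{1/2}») — the TYPE of `global_regularity_3D`, verbatim: for each `t ≥ 0` SOME record `state_t` (unrelated to
`t` or to any flow) has `|spatial|² ≤ initial energy`. [claim: McSheery2026, status: under-review]
[cite: McSheery2026, Lean/Phase4_Regularity/Projection_Regularity.lean l.262–266] -/
def MainRegularityStatement : Prop :=
  ∀ chain : RegularityChain, ∀ t : ℝ, t ≥ 0 →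
    ∃ state_t : FullState6D,
      state_t.x ^ 2 + state_t.y ^ 2 + state_t.z ^ 2 ≤ chain.initial_state.energy

/-- `global_regularity_3D` holds — it re-emits its hypothesis field `energy_preserved` (own proof l.267–270).
[cite: McSheery2026, Lean/Phase4_Regularity/Projection_Regularity.lean l.267–270] -/
theorem mainRegularityStatement_holds : MainRegularityStatement := by
  intro chain t ht
  obtain ⟨s, hs⟩ := chain.energy_preserved t ht
  refine ⟨s, le_trans ?_ hs⟩
  rw [s.energy_decomp]
  nlinarith [sq_nonneg s.temporal, sq_nonneg s.internal]

/-- `NavierStokes_Master.lean` l.196–216 «**THE GLOBAL REGULARITY PRINCIPLE** If the 6D system satisfies D^2 Psi = 0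
(Scleronomic Conservation), then NO blow-up is possible in finite time … theorem Global_Regularity_Principle :
∀ u : Cl33, Commutator u u = 0 ∧ AntiCommutator u u = (2 : ℝ) • (u * u)» with `Commutator A B := A * B - B * A`,
`AntiCommutator A B := A * B + B * A` (`Phase3_Advection/Advection_Pressure.lean` l.41–44) on `Cl33 :=
CliffordAlgebra Q33` — transcribed over an ARBITRARY real algebra `A` (the identity uses nothing of `Cl(3,3)`).
[claim: McSheery2026, status: under-review] [cite: McSheery2026, Lean/NavierStokes_Master.lean l.209–216] -/
def GlobalRegularityPrinciple (A : Type) [Ring A] [Algebra ℝ A] : Prop :=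
  ∀ u : A, u * u - u * u = 0 ∧ u * u + u * u = (2 : ℝ) • (u * u)

/-- `Global_Regularity_Principle` holds in every real algebra (`[u,u] = 0`, `{u,u} = 2u²`).
[cite: McSheery2026, Lean/NavierStokes_Master.lean l.209–216] -/
theorem globalRegularityPrinciple_holds (A : Type) [Ring A] [Algebra ℝ A] : GlobalRegularityPrinciple A :=
  fun u => ⟨sub_self _, by rw [two_smul]⟩

end Literature.Claims.NS.McSheery2026

end

-- WHAT THIS IS NOT: not a claim about NS regularity or blow-up; not a claim about any author beyond the
-- typed locator.
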